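import Summits.Ventures.CertifiedArithmetic.LowPrec.SRPythagorasNested
import Summits.Ventures.CertifiedArithmetic.LowPrec.SRDyadicGridFormats
import HarnessLib

/-!
# Stochastic rounding in low-precision formats XCV — every one-signed window of every format is
# nested: the StochasticA Pythagorean law across binades with `N ≥` (binade span) random bits, no
# enumeration; the threshold attained on E3M2 `[7/4, 5]`

HONEST FRAMING: certified error envelopes and provably optimal rounding/accumulation schemes for
low-precision formats under stated cost models; every table by two implementations; no hardware or
vendor claims.

File XCIV (`SRPythagorasNested`) proved: on a `NestedWindow F lo hi g J` with `0 ≤ lo`, StochasticA with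
`N ≥ J` random bits is drift-antitone and obeys `E(ŝₙ − sₙ)² ≤ n·G²/4 + (n·2^{-N}·G)²`, `G = 2^J·g`, for
every `n`.  Here the hypothesis is discharged STRUCTURALLY for every `Format φ` (so also binary16/32):
* `binadeIdx φ v = shift ⌊v/quantum⌋` (the binade index; local spacing `2^{binadeIdx}·quantum`),
  `valueSet_gap_zero_or_spacing` (on `[0, maxRat]` the candidate gap is `0` or the local spacing);
* `valueSet_nestedWindow`: for values `0 ≤ lo`, `hi` the window `[lo, hi] ∩ valueSet φ` is nested with
  `g = 2^{binadeIdx lo}·quantum` and `J = binadeIdx hi − binadeIdx lo` (grid: representable magnitudes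
  `≥ 2^{m+s}` are multiples of `2^s`; widths: the spacing law; monotonicity: `shift` is monotone);
* `valueSet_stochasticA_acc_sq_le`: StochasticA with `N ≥ binadeIdx hi − binadeIdx lo` random bits —
  as many as the binade boundaries the window may span — obeys the law on `[lo, hi]` with
  `G = 2^{binadeIdx hi}·quantum`, every `n`, every format; `valueSet_stochasticA_acc_sq_le_nonneg`: on the
  whole nonnegative range `N ≥ emaxCode − 1` bits (the tree-exactness budget of LXXX: E2M1 `2`, E4M3 `14`,
  E5M2/binary16 `29`) with `G = 2^{emaxCode−1}·quantum`; `Formats.e2m1_nonneg_A2_law`: FP4, `[0, 6]`, two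
  bits, `G = 2`;
* the threshold `N ≥ J` is attained for EVERY span: `Formats.e3m2_bits_threshold_sharp` (kernel
  witnesses, `J = 1..5`: `J − 1` bits not drift-antitone on a window spanning `J + 1` binades, `J` bits
  are), `Formats.e2m1_two_bits_needed`; and `Formats.e3m2_nested_7_4_5` / `e3m2_threeBinade_A2_law`: on
  E3M2 `[7/4, 5]` (three binades) two bits give the law for every `n` (one bit: XCIII
  `e3m2_threeBinade_A1_not`).
Scope (honest): one-signed windows, no saturation; fewer than `J` bits across `≥ 3` binades: law not
decided (certificate gen17/nested: no violation found, evidence only).  References: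
[ConnollyHighamMary2021, Lemma 4.4]; [ElararEtAl2025, Thm. 3–4]; [Higham2002ASNA, §2.1]; IEEE P3109.
-/

namespace Summit.Ventures.CertifiedArithmetic.LowPrec.SR

open Literature.ComputerArithmetic.ConnollyHighamMary2021
open Finset

namespace LimitedBits

/-! ### Every format: one-signed windows of `valueSet φ` are nested -/

section Formats

open Literature.ComputerArithmetic.FloatingPoint (Format MiniFloat)
open Literature.ComputerArithmetic.FloatingPoint.MiniFloat (valueSet valueSet_nonempty)

/-- The binade index of a nonnegative rational in format `φ`: `shift ⌊v / quantum⌋` (`0` on the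
subnormal and first normal binade, `+1` per binade above; the local spacing is `2^{binadeIdx}·quantum`). -/
def binadeIdx (φ : Format) (v : ℚ) : ℕ := φ.shift ⌊v / φ.quantum⌋.toNat

/-- `binadeIdx` is monotone on `[0, ∞)`. -/
theorem binadeIdx_mono (φ : Format) {v w : ℚ} (hvw : v ≤ w) : binadeIdx φ v ≤ binadeIdx φ w :=
  Format.shift_mono (Int.toNat_le_toNat (Int.floor_le_floor
    (div_le_div_of_nonneg_right hvw φ.quantum_pos.le)))

/-- A nonnegative value of `φ` is `n·quantum` for a representable `n ≤ maxScaled`, and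
`binadeIdx = shift n`. -/
theorem exists_natMul_of_mem {φ : Format} {v : ℚ} (hv : v ∈ valueSet φ) (h0 : 0 ≤ v) :
    ∃ n : ℕ, φ.Representable n ∧ n ≤ φ.maxScaled ∧ v = n * φ.quantum ∧ binadeIdx φ v = φ.shift n := by
  obtain ⟨y, rfl⟩ := MiniFloat.mem_valueSet.mp hv
  have e : y.toRat = y.scaledMag * φ.quantum := by rw [← abs_of_nonneg h0]; exact MiniFloat.abs_toRat y
  refine ⟨y.scaledMag, MiniFloat.representable_scaledMag y, y.scaledMag_le_maxScaled, e, ?_⟩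
  unfold binadeIdx
  rw [e, mul_div_cancel_right₀ _ φ.quantum_pos.ne', Int.floor_natCast, Int.toNat_natCast]

/-- On `[0, maxRat]` the candidate gap of `valueSet φ` is `0` or the local spacing
`2^{binadeIdx c}·quantum`. -/
theorem valueSet_gap_zero_or_spacing (φ : Format) {c : ℚ} (h0 : 0 ≤ c) (hc : c ≤ φ.maxRat) :
    roundUp (valueSet φ) c - roundDown (valueSet φ) c = 0 ∨
      roundUp (valueSet φ) c - roundDown (valueSet φ) c = 2 ^ binadeIdx φ c * φ.quantum := by
  have habs : |c| ≤ φ.maxRat := by rwa [abs_of_nonneg h0]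
  have hq := φ.quantum_pos
  rw [MiniFloat.chm_roundUp_eq habs, MiniFloat.chm_roundDown_eq habs, MiniFloat.roundUp_sub_roundDown_eq,
    abs_of_nonneg h0]
  set r : ℚ := c / φ.quantum with hr
  have hr0 : 0 ≤ r := div_nonneg h0 hq.le
  have hle : r ≤ φ.maxScaled := by rw [hr, div_le_iff₀ hq]; exact hc
  set s := φ.shift ⌊r⌋.toNat with hs
  have hcs : (0 : ℚ) < 2 ^ s := by positivity
  have h0f : 0 ≤ ⌊r / (2 : ℚ) ^ s⌋ := Int.floor_nonneg.mpr (div_nonneg hr0 hcs.le)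
  have h0c : 0 ≤ ⌈r / (2 : ℚ) ^ s⌉ := Int.ceil_nonneg (div_nonneg hr0 hcs.le)
  have e1 : ((⌊r / (2 : ℚ) ^ s⌋.toNat : ℕ) : ℚ) = (⌊r / (2 : ℚ) ^ s⌋ : ℚ) := by
    exact_mod_cast Int.toNat_of_nonneg h0f
  have e2 : ((⌈r / (2 : ℚ) ^ s⌉.toNat : ℕ) : ℚ) = (⌈r / (2 : ℚ) ^ s⌉ : ℚ) := by
    exact_mod_cast Int.toNat_of_nonneg h0c
  have hd : (φ.rdGrid r : ℚ) = (⌊r / (2 : ℚ) ^ s⌋ : ℚ) * 2 ^ s := by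
    rw [Format.rdGrid_eq_floor_mul hr0 hle, ← hs]; push_cast; rw [e1]
  have hu : (φ.ruGrid r : ℚ) = (⌈r / (2 : ℚ) ^ s⌉ : ℚ) * 2 ^ s := by
    unfold Format.ruGrid; rw [if_pos hle, ← hs]; push_cast; rw [e2]
  have h1 := Int.floor_le_ceil (r / (2 : ℚ) ^ s)
  have h2 := Int.ceil_le_floor_add_one (r / (2 : ℚ) ^ s)
  rcases eq_or_lt_of_le h1 with he | hlt
  · left; rw [hd, hu, he]; ring
  · right
    have : ⌈r / (2 : ℚ) ^ s⌉ = ⌊r / (2 : ℚ) ^ s⌋ + 1 := le_antisymm h2 (by omega)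
    rw [hd, hu, this]; push_cast; unfold binadeIdx; rw [← hr, ← hs]; ring

/-- **Every one-signed window of every format is nested**: for values `0 ≤ lo`, `hi` of `φ`,
`[lo, hi] ∩ valueSet φ` is a `NestedWindow` with `g = 2^{binadeIdx lo}·quantum` (the spacing at `lo`)
and `J = binadeIdx hi − binadeIdx lo`.  No enumeration. -/
theorem valueSet_nestedWindow (φ : Format) {lo hi : ℚ} (hlo : lo ∈ valueSet φ) (hhi : hi ∈ valueSet φ)
    (h0 : 0 ≤ lo) :
    NestedWindow (valueSet φ) lo hi (2 ^ binadeIdx φ lo * φ.quantum) (binadeIdx φ hi - binadeIdx φ lo) := by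
  have hq := φ.quantum_pos
  have hF := valueSet_nonempty φ
  have hhimax : hi ≤ φ.maxRat := by
    obtain ⟨y, rfl⟩ := MiniFloat.mem_valueSet.mp hhi
    exact (le_abs_self _).trans (MiniFloat.abs_toRat_le_maxRat y)
  obtain ⟨nlo, hrlo, -, elo, slo⟩ := exists_natMul_of_mem hlo h0
  -- the gap at a window point, as up/dn
  have hgap : ∀ c, lo ≤ c → c ≤ hi → up (valueSet φ) c - dn (valueSet φ) c = 0 ∨
      up (valueSet φ) c - dn (valueSet φ) c = 2 ^ binadeIdx φ c * φ.quantum := by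
    intro c h1 h2
    have hcl : clamp (valueSet φ) c = c := clamp_eq_self ⟨⟨lo, hlo, h1⟩, ⟨hi, hhi, h2⟩⟩
    unfold up dn; rw [hcl]
    exact valueSet_gap_zero_or_spacing φ (h0.trans h1) (h2.trans hhimax)
  refine ⟨hlo, hhi, by positivity, ?_, ?_, ?_⟩
  · -- grid: window values are multiples of the spacing at `lo`
    intro a ha hla _
    obtain ⟨na, hra, -, ea, -⟩ := exists_natMul_of_mem ha (h0.trans hla)
    have hnn : nlo ≤ na := by
      have : (nlo : ℚ) * φ.quantum ≤ na * φ.quantum := by rw [← elo, ← ea]; exact hla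
      exact_mod_cast le_of_mul_le_mul_right this hq
    suffices hM : ∃ M : ℤ, a - lo = M * (2 ^ binadeIdx φ lo * φ.quantum) by
      obtain ⟨M, hM⟩ := hM
      rw [hM, mul_div_cancel_right₀ _ (by positivity), Int.floor_intCast]
    rw [slo]
    by_cases hsmall : nlo < 2 ^ (φ.manBits + 1)
    · refine ⟨(na : ℤ) - nlo, ?_⟩
      rw [Format.shift_eq_zero_of_lt hsmall, pow_zero, one_mul, ea, elo]; push_cast; ring
    · have hge : 2 ^ (φ.manBits + φ.shift nlo) ≤ nlo := Format.pow_shift_le (by rw [pow_succ] at hsmall; omega)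
      obtain ⟨u, hu⟩ := Format.pow_dvd_of_representable hrlo hge
      obtain ⟨u', hu'⟩ := Format.pow_dvd_of_representable hra (hge.trans hnn)
      have cu : (nlo : ℚ) = 2 ^ φ.shift nlo * u := by exact_mod_cast hu
      have cu' : (na : ℚ) = 2 ^ φ.shift nlo * u' := by exact_mod_cast hu'
      refine ⟨(u' : ℤ) - u, ?_⟩
      rw [ea, elo]; push_cast; linear_combination φ.quantum * cu' - φ.quantum * cu
  · -- width: `2^{binadeIdx c} q = 2^{binadeIdx c − binadeIdx lo} · g`
    intro c h1 h2 hne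
    rcases hgap c h1 h2 with h | h
    · exact absurd (sub_eq_zero.mp h) hne
    · refine ⟨binadeIdx φ c - binadeIdx φ lo, Nat.sub_le_sub_right (binadeIdx_mono φ h2) _, ?_⟩
      rw [h, ← mul_assoc, ← pow_add, Nat.sub_add_cancel (binadeIdx_mono φ h1)]
  · -- mono: binade indices do not decrease
    intro c c' h1 hcc h2 hne'
    rcases hgap c' (h1.trans hcc) h2 with h' | h'
    · exact absurd (sub_eq_zero.mp h') hne'
    rw [h']
    rcases hgap c h1 (hcc.trans h2) with h | h
    · rw [h]; positivity
    · rw [h]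
      exact mul_le_mul_of_nonneg_right (pow_le_pow_right₀ (by norm_num) (binadeIdx_mono φ hcc)) hq.le

/-- **The Pythagorean law for StochasticA on every one-signed window of every format.**  For values
`0 ≤ lo ≤ hi` of `φ` and `N ≥ binadeIdx hi − binadeIdx lo` random bits, every StochasticA accumulation
confined to `[lo, hi]` (no saturation) satisfies, for every `n`,
`E(ŝₙ − sₙ)² ≤ n·G²/4 + (n·2^{-N}·G)²` with `G = 2^{binadeIdx hi}·quantum`. -/
theorem valueSet_stochasticA_acc_sq_le (φ : Format) {lo hi : ℚ} (hlo : lo ∈ valueSet φ)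
    (hhi : hi ∈ valueSet φ) (h0 : 0 ≤ lo) (hle : lo ≤ hi) {N : ℕ}
    (hN : binadeIdx φ hi ≤ binadeIdx φ lo + N) (x : ℕ → ℚ) (n : ℕ) (s : ℚ)
    (hns : NoSat (valueSet φ) x n s) (hw : InWindow (valueSet φ) lo hi x n s) :
    accExpQ (valueSet φ) (probAwayA N) x n (fun t => (t - (s + ∑ i ∈ range n, x i)) ^ 2) s
      ≤ n * ((2 ^ binadeIdx φ hi * φ.quantum) ^ 2 / 4)
        + (n * (1 / 2 ^ N * (2 ^ binadeIdx φ hi * φ.quantum))) ^ 2 := by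
  have h := (valueSet_nestedWindow φ hlo hhi h0).stochasticA_acc_sq_le h0 (N := N) (by omega) x n s hns hw
  have e : (2 : ℚ) ^ (binadeIdx φ hi - binadeIdx φ lo) * (2 ^ binadeIdx φ lo * φ.quantum)
      = 2 ^ binadeIdx φ hi * φ.quantum := by
    rw [← mul_assoc, ← pow_add, Nat.sub_add_cancel (binadeIdx_mono φ hle)]
  rwa [e] at h

/-- **Whole nonnegative range, every format.**  With `N ≥ emaxCode − 1` random bits (the tree-exactness
budget of LXXX: E4M3 `14`, E5M2 `29`, binary16 `29`) every StochasticA accumulation confined to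
`[0, maxRat]` obeys the law with `G = 2^{emaxCode−1}·quantum`, for every `n`. -/
theorem valueSet_stochasticA_acc_sq_le_nonneg (φ : Format) {N : ℕ} (hN : φ.emaxCode - 1 ≤ N)
    (x : ℕ → ℚ) (n : ℕ) (s : ℚ) (hns : NoSat (valueSet φ) x n s)
    (hw : InWindow (valueSet φ) 0 φ.maxRat x n s) :
    accExpQ (valueSet φ) (probAwayA N) x n (fun t => (t - (s + ∑ i ∈ range n, x i)) ^ 2) s
      ≤ n * ((2 ^ (φ.emaxCode - 1) * φ.quantum) ^ 2 / 4)
        + (n * (1 / 2 ^ N * (2 ^ (φ.emaxCode - 1) * φ.quantum))) ^ 2 := by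
  have hq := φ.quantum_pos
  have h0mem : (0 : ℚ) ∈ valueSet φ := MiniFloat.mem_valueSet.mpr ⟨MiniFloat.zero φ, MiniFloat.toRat_zero⟩
  have htop : binadeIdx φ φ.maxRat ≤ φ.emaxCode - 1 := Format.shift_le _
  have h := valueSet_stochasticA_acc_sq_le φ h0mem (MiniFloat.maxRat_mem_valueSet φ) le_rfl
    (mul_nonneg (by positivity) φ.quantum_pos.le) (N := N) (by omega) x n s hns hw
  refine h.trans ?_
  have hG : (2 : ℚ) ^ binadeIdx φ φ.maxRat * φ.quantum ≤ 2 ^ (φ.emaxCode - 1) * φ.quantum :=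
    mul_le_mul_of_nonneg_right (pow_le_pow_right₀ (by norm_num) htop) φ.quantum_pos.le
  have hG0 : (0 : ℚ) ≤ 2 ^ binadeIdx φ φ.maxRat * φ.quantum := mul_nonneg (by positivity) hq.le
  gcongr

end Formats

end LimitedBits

namespace Formats

open LimitedBits
open Literature.ComputerArithmetic.FloatingPoint (Format)

/-- The E3M2 window `[7/4, 5]` (spacings `1/4, 1/2, 1`) is nested with `g = 1/4`, `J = 2`
(from `valueSet_nestedWindow`, binade indices `2` and `4`). -/
theorem e3m2_nested_7_4_5 : NestedWindow e3m2 (7 / 4) 5 (1 / 4) 2 := by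
  have h := valueSet_nestedWindow Format.E3M2 (lo := 7 / 4) (hi := 5)
    (by rw [← e3m2_eq_valueSet]; decide +kernel) (by rw [← e3m2_eq_valueSet]; decide +kernel) (by norm_num)
  have h1 : binadeIdx Format.E3M2 (7 / 4) = 2 := by decide +kernel
  have h2 : binadeIdx Format.E3M2 5 = 4 := by decide +kernel
  have hq : Format.E3M2.quantum = 1 / 16 := by decide +kernel
  rw [h1, h2, hq, ← e3m2_eq_valueSet] at h
  norm_num at h
  exact h

/-- **Threshold attained at `J = 2`.**  On E3M2 `[7/4, 5]` — three binades, where ONE random bit is not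
drift-antitone (XCIII `e3m2_threeBinade_A1_not`) — StochasticA with `N ≥ 2` bits obeys
`E(ŝₙ − sₙ)² ≤ n/4 + (n/2^N)²` for every `n` (`G = 1`, `ε = 2^{-N}`). -/
theorem e3m2_threeBinade_A2_law {N : ℕ} (hN : 2 ≤ N) (x : ℕ → ℚ) (n : ℕ) (s : ℚ)
    (hns : NoSat e3m2 x n s) (hw : InWindow e3m2 (7 / 4) 5 x n s) :
    accExpQ e3m2 (probAwayA N) x n (fun t => (t - (s + ∑ i ∈ range n, x i)) ^ 2) s
      ≤ n * ((1 : ℚ) ^ 2 / 4) + (n * (1 / 2 ^ N * 1)) ^ 2 :=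
  (e3m2_nested_7_4_5.stochasticA_acc_sq_le (by norm_num) hN x n s hns hw).trans (le_of_eq (by ring))

/-- **FP4, whole nonnegative range.**  Every StochasticA accumulation confined to `[0, 6] ⊂ E2M1` with
`N ≥ 2` random bits satisfies `E(ŝₙ − sₙ)² ≤ n + (2n/2^N)²` for every `n` (`G = 2`, the top spacing). -/
theorem e2m1_nonneg_A2_law {N : ℕ} (hN : 2 ≤ N) (x : ℕ → ℚ) (n : ℕ) (s : ℚ) (hns : NoSat FP4.e2m1 x n s)
    (hw : InWindow FP4.e2m1 0 6 x n s) :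
    accExpQ FP4.e2m1 (probAwayA N) x n (fun t => (t - (s + ∑ i ∈ range n, x i)) ^ 2) s
      ≤ n * ((2 : ℚ) ^ 2 / 4) + (n * (1 / 2 ^ N * 2)) ^ 2 := by
  have hq : Format.E2M1.quantum = 1 / 2 := by decide +kernel
  have hm : Format.E2M1.maxRat = 6 := by decide +kernel
  have he : Format.E2M1.emaxCode - 1 = 2 := by decide
  rw [e2m1_eq_valueSet] at hns hw ⊢
  rw [← hm] at hw
  have h := valueSet_stochasticA_acc_sq_le_nonneg Format.E2M1 (N := N) (by omega) x n s hns hw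
  rw [he, hq] at h
  exact h.trans (le_of_eq (by ring))

/-- **The threshold `N ≥ J` is attained for every span (kernel witnesses, two summands each).**  On
E3M2, for `J = 1, …, 5`: a StochasticA tree with `J − 1` random bits confined to a one-signed window
spanning `J + 1` binades (`[2, 5]`, `[7/4, 5]`, `[1, 10]`, `[1/2, 10]`, `[0, 10]`) that is NOT
drift-antitone, while with `J` bits it is (as `valueSet_stochasticA_acc_sq_le` guarantees): the first
summand puts the partial sum just above a point `d` of the finest binade (candidates `d`, `d + g`), the
second carries both candidates into one cell of the coarsest binade, on either side of a boundary of its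
`2^{J−1}` sub-quanta (`2g` wide each), so the two step means differ by `2g > g` (`J = 2` is XCIII's
`e3m2_threeBinade_A1_not`).  The sr-seat certificate gen17/nested reproduces these exactly. -/
theorem e3m2_bits_threshold_sharp :
    (InWindow e3m2 2 5 (seqL [5 / 4, 5 / 2]) 2 1 ∧
      ¬ DriftAntitone e3m2 (probAwayA 0) (seqL [5 / 4, 5 / 2]) 2 1 ∧
      DriftAntitone e3m2 (probAwayA 1) (seqL [5 / 4, 5 / 2]) 2 1) ∧
    (InWindow e3m2 (7 / 4) 5 (seqL [-9 / 8, 5 / 2]) 2 3 ∧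
      ¬ DriftAntitone e3m2 (probAwayA 1) (seqL [-9 / 8, 5 / 2]) 2 3 ∧
      DriftAntitone e3m2 (probAwayA 2) (seqL [-9 / 8, 5 / 2]) 2 3) ∧
    (InWindow e3m2 1 10 (seqL [1 / 8, 67 / 8]) 2 1 ∧
      ¬ DriftAntitone e3m2 (probAwayA 2) (seqL [1 / 8, 67 / 8]) 2 1 ∧
      DriftAntitone e3m2 (probAwayA 3) (seqL [1 / 8, 67 / 8]) 2 1) ∧
    (InWindow e3m2 (1 / 2) 10 (seqL [1 / 16, 135 / 16]) 2 (1 / 2) ∧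
      ¬ DriftAntitone e3m2 (probAwayA 3) (seqL [1 / 16, 135 / 16]) 2 (1 / 2) ∧
      DriftAntitone e3m2 (probAwayA 4) (seqL [1 / 16, 135 / 16]) 2 (1 / 2)) ∧
    (InWindow e3m2 0 10 (seqL [1 / 32, 519 / 64]) 2 0 ∧
      ¬ DriftAntitone e3m2 (probAwayA 4) (seqL [1 / 32, 519 / 64]) 2 0 ∧
      DriftAntitone e3m2 (probAwayA 5) (seqL [1 / 32, 519 / 64]) 2 0) := by
  refine ⟨⟨?_, ?_, ?_⟩, ⟨?_, ?_, ?_⟩, ⟨?_, ?_, ?_⟩, ⟨?_, ?_, ?_⟩, ⟨?_, ?_, ?_⟩⟩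
  all_goals first
    | (rw [← inWindowB_iff]; decide +kernel)
    | (rw [← driftAntitoneB_iff]; decide +kernel)

/-- **FP4: two bits are needed on `[0, 6]`.**  From `1/2` with summands `1/8, 4` (window `[1/2, 6]`,
spacings `1/2, 1, 2`) one random bit is not drift-antitone; two bits are (`e2m1_nonneg_A2_law`). -/
theorem e2m1_two_bits_needed :
    InWindow FP4.e2m1 0 6 (seqL [1 / 8, 4]) 2 (1 / 2) ∧
      ¬ DriftAntitone FP4.e2m1 (probAwayA 1) (seqL [1 / 8, 4]) 2 (1 / 2) ∧
      DriftAntitone FP4.e2m1 (probAwayA 2) (seqL [1 / 8, 4]) 2 (1 / 2) := by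
  refine ⟨?_, ?_, ?_⟩
  · rw [← inWindowB_iff]; decide +kernel
  · rw [← driftAntitoneB_iff]; decide +kernel
  · rw [← driftAntitoneB_iff]; decide +kernel

end Formats

end Summit.Ventures.CertifiedArithmetic.LowPrec.SR
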